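import Summits.CriticalPhenomena.SAWScalingLimit.Theses.SAWWeldingIdentification
import Summits.CriticalPhenomena.SAWScalingLimit.Theorems.SAWRenewalTightnessTightOfShellCrossing
import Literature.Probability.RandomPlanarGeometry.CurvePVariation
import HarnessLib

/-!
# Strategist sketch s3-B (crux stmt-CriticalPhenomena-1372 `EventualTight`, bet route `SAWWeldingIdentification`)

Instance B of seat `planner-cstrat-stmt-CriticalPhenomena-1372-s3-0` (two instances ran concurrently in
one folder; instance A's sketch is `StrategistSketch_s3.lean` = `NoFjordAllScales → NoReturnTight`).
Typed companions of the `## Strengthen` heading of the s3 census section (welding-route world):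

* `PVariationTight p` — tightness of the `p`-variation of the pushed critical SAW polylines
  (ONE controlling random variable for all shells at once; the rough-path / welding-regularity
  form of precompactness).  `eventualTight_of_pVariationTight` PROVES `PVariationTight p →
  EventualTight` (this route's decl, by name) from the tree's compactness lemma
  `CurveClass.isCompact_closure_image_mk_of_pVariation_le` (AB99 Lemma 4.1 via tortuosity).
  This is most of the open support item stmt-CriticalPhenomena-5892
  `SAWExpectedSignature.PVarMomentsTight` (what remains there: Markov at `n = 1`, the inlined `pv` =
  `Curve.pVariation`, and the landed set-form → along-mesh bridge).
* `HolderParamTight` — whp the polyline has an `α`-Hölder parametrisation with constant `M`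
  (what "one bank of the lattice chord is a uniform Hölder domain" delivers: the restriction of the
  Hölder uniformiser to an arc of the circle); it gives `PVariationTight (1/α)`-type bounds.
* `BoundedTurningTight` — whp the polyline is `C`-bounded-turning (Ahlfors' three-point
  condition = the quasisymmetric-welding class, where welding ⟹ curve compactness is classical);
  expected FALSE given the conjunct (SLE₈⸝₃ is not bounded-turning), recorded so nobody files it.

Nothing here is filed as an item; see `Cruxes/EventualTight/STRATEGY-CENSUS.md` (s3 section).
-/

noncomputable section

open MeasureTheory Filter Topology Set Metric
open scoped ENNReal NNReal unitInterval
open Literature.Probability.RandomPlanarGeometry Literature.Probability.LatticeModels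

namespace Summit.CriticalPhenomena.SAWScalingLimit.Cruxes.EventualTight.StrategistS3

/-- **S⁺_V `PVariationTight p`**: for every Dobrushin domain and endpoint approximation there is
`δ₀ > 0` such that the `p`-variation `V_p` of the pushed critical SAW polyline is a TIGHT random
variable uniformly in `δ ∈ (0, δ₀]`: for every `θ > 0` some level `M` has
`P_δ[V_p(γ_δ) > M] ≤ θ` for all such `δ`. (For SLE₈⸝₃ the optimal index is `p > 4/3`.) -/
def PVariationTight (p : ℝ) : Prop :=
  ∀ (D : DobrushinDomain) (a b : ℝ → Site 2), SAW.IsEndpointApprox D a b →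
    ∃ δ₀ : ℝ, 0 < δ₀ ∧ ∀ θ : ℝ, 0 < θ → ∃ M : ℝ, 0 ≤ M ∧ ∀ δ ∈ Set.Ioc (0 : ℝ) δ₀,
      SAW.law D.carrier δ (a δ) (b δ)
        {γ | ENNReal.ofReal M < (⟨γ.walk.toCurve (meshPoint δ)⟩ : Curve ℂ).pVariation p} ≤
        ENNReal.ofReal θ

/-- **S⁺_H `HolderParamTight`**: whp (uniformly in small `δ`) the pushed SAW polyline admits a
parametrisation by `[0,1]` that is `α`-Hölder with constant `M` — the curve-level shadow of
"one bank of the completed lattice chord is an `(α, M)`-Hölder domain" (route plan: `HölderBanks`,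
the foreseen child of `RemovableLimit`). -/
def HolderParamTight : Prop :=
  ∀ (D : DobrushinDomain) (a b : ℝ → Site 2), SAW.IsEndpointApprox D a b →
    ∃ δ₀ : ℝ, 0 < δ₀ ∧ ∀ θ : ℝ, 0 < θ → ∃ (α M : ℝ), 0 < α ∧ 0 ≤ M ∧ ∀ δ ∈ Set.Ioc (0 : ℝ) δ₀,
      SAW.law D.carrier δ (a δ) (b δ)
        {γ | ∃ f : I → ℂ, CurveClass.mk ⟨γ.walk.toCurve (meshPoint δ)⟩ = γ.curve ∧
            (∃ φ : I → I, Continuous φ ∧ Monotone φ ∧ Function.Surjective φ ∧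
              f = (⟨γ.walk.toCurve (meshPoint δ)⟩ : Curve ℂ) ∘ φ) ∧
            ∀ s t : I, dist (f s) (f t) ≤ M * dist s t ^ α}ᶜ ≤
        ENNReal.ofReal θ

/-- **S⁺_QS `BoundedTurningTight`**: whp (uniformly in small `δ`) the pushed SAW polyline is
`C`-bounded-turning: the diameter of every sub-arc is at most `C` times the distance of its
endpoints (Ahlfors' condition; such arcs are `K(C)`-quasiarcs, the quasisymmetric-welding class). -/
def BoundedTurningTight : Prop :=
  ∀ (D : DobrushinDomain) (a b : ℝ → Site 2), SAW.IsEndpointApprox D a b →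
    ∃ δ₀ : ℝ, 0 < δ₀ ∧ ∀ θ : ℝ, 0 < θ → ∃ C : ℝ, ∀ δ ∈ Set.Ioc (0 : ℝ) δ₀,
      SAW.law D.carrier δ (a δ) (b δ)
        {γ | ∀ s t u : I, s ≤ t → t ≤ u →
            dist ((⟨γ.walk.toCurve (meshPoint δ)⟩ : Curve ℂ) s)
                ((⟨γ.walk.toCurve (meshPoint δ)⟩ : Curve ℂ) t) ≤
              C * dist ((⟨γ.walk.toCurve (meshPoint δ)⟩ : Curve ℂ) s)
                ((⟨γ.walk.toCurve (meshPoint δ)⟩ : Curve ℂ) u)}ᶜ ≤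
        ENNReal.ofReal θ

/-- **`PVariationTight p → EventualTight`** (this route's decl, by name): tightness of ONE
functional, the `p`-variation, gives precompactness of the pushed laws — the compact sets are the
closures of `{range ⊆ Λ, V_p ≤ M}` (`CurveClass.isCompact_closure_image_mk_of_pVariation_le`,
AB99 Lemma 4.1 through `M(γ, 2ℓ) ≤ V_p/ℓ^p + 1`), with `Λ` a closed disc containing the domain and
the unit disc about the first marked point (the lattice start `a_δ` may lie off `Ω̄`; it is within
`1` of `a` for small `δ` by the endpoint approximation, exactly as in `TightOfShellCrossing_proof`).
[cite: AizenmanBurchardDuke1999, Lemma 4.1] -/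
theorem eventualTight_of_pVariationTight {p : ℝ} (hp : 0 ≤ p) (hV : PVariationTight p) :
    Summit.CriticalPhenomena.SAWScalingLimit.Theses.SAWWeldingIdentification.EventualTight := by
  intro D a b hab
  classical
  obtain ⟨δ₁, hδ₁, hM⟩ := hV D a b hab
  -- the endpoint `a_δ` is within `1` of the marked point `a` for small `δ`
  have hnear : ∀ᶠ δ in 𝓝[>] (0 : ℝ), meshPoint δ (a δ) ∈ ball (D.pt 0) 1 :=
    hab.tendsto_fst.eventually_mem (ball_mem_nhds _ one_pos)
  obtain ⟨δ₂, hδ₂, hsub₂⟩ := mem_nhdsGT_iff_exists_Ioo_subset.1 hnear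
  have hδ₂' : (0 : ℝ) < δ₂ := hδ₂
  -- a disc containing the domain and the unit disc about `a`
  obtain ⟨r, hr⟩ := D.isBounded.subset_closedBall (0 : ℂ)
  set rΛ : ℝ := max r 0 + ‖D.pt 0‖ + 1 with hrΛ
  have hΩ : D.carrier ⊆ closedBall (0 : ℂ) rΛ := hr.trans (closedBall_subset_closedBall (by
    rw [hrΛ]; linarith [le_max_left r 0, norm_nonneg (D.pt 0)]))
  have hball : ball (D.pt 0) 1 ⊆ closedBall (0 : ℂ) rΛ := by
    intro z hz
    rw [mem_ball] at hz
    rw [mem_closedBall, dist_zero_right]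
    have := norm_le_norm_add_norm_sub' z (D.pt 0)
    rw [← dist_eq_norm] at this
    rw [hrΛ]
    linarith [le_max_right r 0]
  -- the mesh threshold
  set δ₀ : ℝ := min δ₁ (δ₂ / 2) with hδ₀
  have hδ₀pos : 0 < δ₀ := lt_min hδ₁ (half_pos hδ₂')
  have hδ₀δ₁ : δ₀ ≤ δ₁ := min_le_left _ _
  have hδ₀δ₂ : δ₀ < δ₂ := (min_le_right _ _).trans_lt (half_lt_self hδ₂')
  refine ⟨δ₀, hδ₀pos, ?_⟩
  -- ranges lie in the disc for `δ ∈ (0, δ₀]`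
  have hrange : ∀ δ ∈ Set.Ioc (0 : ℝ) δ₀, ∀ γ : SAW.DomainSAW D.carrier δ (a δ) (b δ),
      (⟨γ.walk.toCurve (meshPoint δ)⟩ : Curve ℂ).range ⊆ closedBall 0 rΛ := by
    intro δ hδ γ
    refine Theorems.range_toCurve_domainSAW_subset γ fun q hq ↦ ?_
    rw [SimpleGraph.Walk.mem_support_iff] at hq
    rcases hq with rfl | hq
    · exact hball (hsub₂ ⟨hδ.1, hδ.2.trans_lt hδ₀δ₂⟩)
    · exact hΩ (meshDomain_subset_meshVertices _ _
        (Theorems.mem_meshDomain_of_mem_tail_support γ.walk q hq))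
  -- tightness: for `ε`, the compact set `closure (mk '' {range ⊆ Λ, V_p ≤ M(ε)})`
  rw [isTightMeasureSet_iff_exists_isCompact_measure_compl_le]
  intro ε hε
  rcases eq_or_ne ε ⊤ with rfl | hεtop
  · exact ⟨∅, isCompact_empty, fun μ _ ↦ le_top⟩
  have hεr : 0 < ε.toReal := ENNReal.toReal_pos hε.ne' hεtop
  obtain ⟨M, hM0, hMbound⟩ := hM ε.toReal hεr
  set 𝒦 : Set (Curve ℂ) :=
    {γ | γ.range ⊆ closedBall (0 : ℂ) rΛ ∧ γ.pVariation p ≤ ENNReal.ofReal M} with h𝒦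
  have h𝒦c : IsCompact (closure (CurveClass.mk '' 𝒦)) := by
    have h := CurveClass.isCompact_closure_image_mk_of_pVariation_le (E := ℂ)
      (isCompact_closedBall (0 : ℂ) rΛ) hp (M := ENNReal.ofReal M) ENNReal.ofReal_ne_top
    exact h
  refine ⟨closure (CurveClass.mk '' 𝒦), h𝒦c, ?_⟩
  rintro μ ⟨δ, hδ, rfl⟩
  have hmeas : Measurable fun γ : SAW.DomainSAW D.carrier δ (a δ) (b δ) ↦ γ.curve :=
    SAW.DomainSAW.measurable_of_top _
  rw [Measure.map_apply hmeas h𝒦c.isClosed.measurableSet.compl]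
  calc SAW.law D.carrier δ (a δ) (b δ) ((fun γ ↦ γ.curve) ⁻¹' (closure (CurveClass.mk '' 𝒦))ᶜ)
      ≤ SAW.law D.carrier δ (a δ) (b δ)
          {γ | ENNReal.ofReal M < (⟨γ.walk.toCurve (meshPoint δ)⟩ : Curve ℂ).pVariation p} := by
        refine measure_mono fun γ hγ ↦ ?_
        simp only [mem_preimage, mem_compl_iff] at hγ
        simp only [mem_setOf_eq]
        by_contra hle
        exact hγ (subset_closure ⟨_, ⟨hrange δ hδ γ, not_lt.1 hle⟩, rfl⟩)
    _ ≤ ENNReal.ofReal ε.toReal := hMbound δ ⟨hδ.1, hδ.2.trans hδ₀δ₁⟩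
    _ = ε := ENNReal.ofReal_toReal hεtop

/-- The two route copies of the shared crux agree, so the above is also the `SAWRenewalTightness`
statement. -/
theorem eventualTight_renewal_of_pVariationTight {p : ℝ} (hp : 0 ≤ p) (hV : PVariationTight p) :
    Summit.CriticalPhenomena.SAWScalingLimit.Theses.SAWRenewalTightness.EventualTight :=
  eventualTight_of_pVariationTight hp hV

end Summit.CriticalPhenomena.SAWScalingLimit.Cruxes.EventualTight.StrategistS3

end
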